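import Mathlib
import Summits.Ventures.HodgeRepro2.T6N42HypFlath
import Summits.Ventures.HodgeRepro2.T6N42FlathMain
import Summits.Ventures.HodgeRepro2.T6N42Toy

/-!
# T6N42FlathToy — non-vacuity of the two Flath displays (README §10.5(ii)(c)/(d)): a toy shape on
which `Hyp.GetzHahn2024_Thm5_7_1` and `Hyp.GetzHahn2024_Sec5_7_Note` hold JOINTLY, and the
corollary of `T6N42FlathMain.lean` runs on it (owner t6-p5)

The toy: one place, the trivial group at it and as the adelic group, `W = ℂ` with the trivial action;
«`W` is factorizable through `(W_v)_v`» is MODELLED by the property print leaves on the components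
(author copy p. 108 ll. 52–54: the components of a factorizable admissible irreducible `W` are
admissible and irreducible) — a model of the relation for the non-vacuity witness only, not a
construction of `⊗′_v W_v`. On it: `toyShape_thm` (the factorization exists: the trivial component),
`toyShape_note` (the equivalence holds), `toyShape_joint` (both at once — (ii)(d)), and the
corollary's output `toy_components_irreducibleSmooth`. The irreducibility / smoothness of the trivial
representation of the trivial group are `N42Toy.trivial_irreducible` / `N42Toy.trivial_smooth`
(T6N42Toy p401312, reused by import).

README §8(d): uses an L-value-free non-vanishing device: NO (TIER5 §N4.2, a pre-02:16Z line of
record, continued).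

Filed in Tier-6 WAVE 1 as p438326 (proposed 2026-08-26T10:33:36Z, ACCEPTED, commit 63c515235da5);
this v2 differs from the filed bytes in this module docstring only (the staged-record wording
dropped; every declaration byte-identical to v1).
-/

namespace Summit.Ventures.HodgeRepro2.T6.N42Flath

open Summit.Ventures.HodgeRepro2
open Summit.Ventures.HodgeRepro2.T6.N42Toy

/-- The trivial representation of the trivial group on `ℂ` is admissible: smooth (`trivial_smooth`),
and its invariants under any subgroup form a submodule of the finite-dimensional `ℂ`. -/
theorem trivial_isAdmissible : IsAdmissible (Representation.trivial ℂ Unit ℂ) :=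
  ⟨trivial_smooth, fun _ _ _ => inferInstance⟩

/-- `ℂ` with the trivial action of the trivial group, as a local representation. -/
def trivialLocalRep : LocalRep Unit where
  V := ℂ
  ρ := Representation.trivial ℂ Unit ℂ

/-- The trivial local representation is admissible and irreducible. -/
theorem trivialLocalRep_admissibleIrreducible :
    IsAdmissible trivialLocalRep.ρ ∧ trivialLocalRep.ρ.IsIrreducible :=
  ⟨trivial_isAdmissible, trivial_irreducible⟩

/-- THE TOY SHAPE: one place, trivial groups, `W = ℂ` with the trivial action; «factorizable through
`(W_v)_v`» modelled by «every `W_v` is admissible and irreducible» (see the module docstring). -/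
def toyShape : FactorizationShape where
  Place := Unit
  G := fun _ => Unit
  GA := Unit
  W := ℂ
  ρ := Representation.trivial ℂ Unit ℂ
  Factorizable := fun Wv => ∀ v, IsAdmissible (Wv v).ρ ∧ (Wv v).ρ.IsIrreducible

/-- The toy's `W` is admissible and irreducible. -/
theorem toyShape_admissibleIrreducible : toyShape.AdmissibleIrreducible :=
  ⟨trivial_isAdmissible, trivial_irreducible⟩

/-- Theorem 5.7.1 holds on the toy: `W` factors through the trivial component. -/
theorem toyShape_thm : Hyp.GetzHahn2024_Thm5_7_1 toyShape :=
  fun _ => ⟨fun _ => trivialLocalRep, fun _ => trivialLocalRep_admissibleIrreducible⟩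

/-- The §5.7 note holds on the toy. -/
theorem toyShape_note : Hyp.GetzHahn2024_Sec5_7_Note toyShape :=
  fun _ hWv => ⟨fun _ => hWv, fun _ => toyShape_admissibleIrreducible⟩

/-- §10.5(ii)(d): both displays hold on the toy at once. -/
theorem toyShape_joint :
    Hyp.GetzHahn2024_Thm5_7_1 toyShape ∧ Hyp.GetzHahn2024_Sec5_7_Note toyShape :=
  ⟨toyShape_thm, toyShape_note⟩

/-- The corollary on the toy: the chosen components are irreducible and smooth. -/
theorem toy_components_irreducibleSmooth :
    toyShape.LocalIrreducibleSmooth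
      (toyShape.components toyShape_thm toyShape_note toyShape_admissibleIrreducible) :=
  toyShape.components_irreducibleSmooth toyShape_thm toyShape_note toyShape_admissibleIrreducible

/-- The toy is NOT a degenerate instance of the displays: the hypothesis `AdmissibleIrreducible` is
met, so the displays' conclusions are exercised (the factorization is not obtained vacuously). -/
theorem toyShape_exists_factorization :
    ∃ Wv : ∀ v, LocalRep (toyShape.G v), toyShape.Factorizable Wv :=
  toyShape_thm toyShape_admissibleIrreducible

end Summit.Ventures.HodgeRepro2.T6.N42Flath
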